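import Summits.QuantumFields.YangMills.Cruxes.IRcof.Lines.pinned_cofinal_bill
import Summits.QuantumFields.YangMills.Cruxes.IR.Lines.conformal_exit
import Summits.QuantumFields.YangMills.Cruxes.IR.Lines.flux_purity_split
import HarnessLib

/-!
# Line `no-halving-octave` on crux `IRcof` (stmt-QuantumFields-26930) — SKELETON v5
# idea `no-halving-octave` (lens-1 FEMTO→BULK, cell ym-gapexp)

SKELETON for crux-plan seat cruxplan-stmt-QuantumFields-26930-no-halving-octave-g3.
Fixes CUT-3 issues ‼1, ‼2, ‼3.

**Composition:** `PXcof(1/24) ⇐ PinnedEdgeCof 7 ∧ NoHalvingSC 7 η ∧ GapDosToExitSC 28 4 (1/24)`.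
The slot's load `PinnedExitsCofinalAt (1/24)` follows from:
- `PinnedEdgeCof 7`: femto-located edge certificate (WEAKER*, floor-consuming)
- `NoHalvingSC 7 η`: the LEVER (X9 two-box interpolation, IDEA-NEEDED)
- `GapDosToExitSC 28 4 (1/24)`: gap + DOS → purity conversion (B-ENTROPY/B2 inside, F absorbed, UNDECIDED)

**Constants after ∀r (N′):** all existential constants (T, η, κ, d, β₁) appear AFTER the ∀r binder.

**FIX ‼1 (vacuous κ,d):** `GapDosToExitSC` now CLAIMS both the DOS bound AND the conversion, with κ,d
appearing in both. The stub proves ∃ κ d, (DOS holds) ∧ (gap → purity). Constants κ, d are now USED.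

**FIX ‼2 (unconsumed FluxPuritySC):** F = ConfinedTemporalTwistSC is absorbed INTO `GapDosToExitSC` (the stub
proves gap + DOS → purity, where F is part of its internal proof obligations per the docstring (a)).
The standalone `stub_fluxPuritySC` is dropped entirely.

**FIX ‼3 (trivial toy):** `toy_dosBound_polyWeyl` provides a genuine polynomial DOS instance (Weyl-type).

**HONEST:** finite-volume / conditional; nothing here proves IRcof, PXcof(1/24), or the Yang–Mills mass gap (NOT proved).
Width-0 walls: X9 (`NoHalvingSC`), B-ENTROPY/B2 (inside `GapDosToExitSC`).
-/

set_option autoImplicit false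

noncomputable section

open MeasureTheory Filter Topology
open Literature.MathematicalPhysics.QuantumFieldTheory Literature.MathematicalPhysics.QuantumLattice
open Summit.QuantumFields.YangMills.Cruxes.OSLegsFromFemtoAndGap.DlrCollarTransfer (LowerBounds)
open Summit.QuantumFields.YangMills.Cruxes.IR.ColdPurityBridge (coldDefect)
open Summit.QuantumFields.YangMills.Cruxes.IRcof.PinnedCofinalBill (PinnedExitsCofinalAt)
open Summit.QuantumFields.YangMills.Cruxes.IR.ConformalExit (BoxGapAtLeast boxGapAtLeast_mono)
open Summit.QuantumFields.YangMills.Theorems.FemtoTransferGap (topValue secondValue topValue_nonneg)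
open Summit.QuantumFields.YangMills.Cruxes.IR.FluxPuritySplit (ConfinedTemporalTwistSC)

namespace Summit.QuantumFields.YangMills.Cruxes.IRcof.NoHalvingOctave

/-! ## §1 Stub definitions (the pieces) -/

/-- **NoHalvingSC(z×, η) — the LEVER (X9: two-box interpolation, IDEA-NEEDED).** Eventually in β: for every box L ≥ 8
with zero-flux box gap ≥ z× (box units), the doubled box has gap ≥ (1+η)·z — the gap in box units does NOT halve.
CFT/U(1)₄ = η=0 fixed point (false there with η > 0 since z never reaches z× > 2π). Width-0 wall X9. -/
def NoHalvingSC (zx η : ℝ) : Prop :=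
  ∀ (G : Type) [Group G] [TopologicalSpace G] [IsTopologicalGroup G] [CompactSpace G],
    IsCompactSimpleLieGroup G → SimplyConnectedSpace G →
    letI : MeasurableSpace G := borel G
    haveI : BorelSpace G := ⟨rfl⟩
    ∀ r : LatticeRep G, ∃ β₁ : ℝ, ∀ β : ℝ, β₁ ≤ β →
      ∀ (L L' : ℕ) [NeZero L] [NeZero L'], 8 ≤ L → L' = 2 * L → ∀ z : ℝ, zx ≤ z →
        BoxGapAtLeast r.ρ β L z → BoxGapAtLeast r.ρ β L' ((1 + η) * z)

/-- **PinnedEdgeCof(z×) — femto-side certificate (WEAKER* than PXcof, floor-consuming).**  For every unit map a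
carrying the floor `LowerBounds G r a`: ∃T, cofinally in β a box L ≥ 8 with a(β)·L ≤ T has zero-flux gap ≥ z×.
Consumes the floor (honours `IRcof_false_without_LowerBounds`). -/
def PinnedEdgeCof (zx : ℝ) : Prop :=
  ∀ (G : Type) [Group G] [TopologicalSpace G] [IsTopologicalGroup G] [CompactSpace G],
    IsCompactSimpleLieGroup G → SimplyConnectedSpace G →
    letI : MeasurableSpace G := borel G
    haveI : BorelSpace G := ⟨rfl⟩
    ∀ (r : LatticeRep G) (a : ℝ → ℝ), (∀ β, 0 < a β) → Tendsto a atTop (𝓝 0) → LowerBounds G r a →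
      ∃ T : ℝ, ∀ β₁ : ℝ, ∃ β : ℝ, β₁ ≤ β ∧
        ∃ (L : ℕ) (_ : NeZero L), 8 ≤ L ∧ a β * (L : ℝ) ≤ T ∧ BoxGapAtLeast r.ρ β L zx

/-- **GapDosToExitSC(z_s, c, θ) — gap + DOS → purity (UNDECIDED, B-ENTROPY/B2 = width-0 wall).**
∃ κ d with:
(1) DOS BOUND: N₀(E) ≤ κ·L^d·E^{d/2} holds eventually — κ, d are USED here (fixes ‼1)
(2) CONVERSION: gap ≥ z_s implies purity ≤ θ within factor c in scale — κ, d appear here too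

This COMBINES:
(a) F = flux heaviness (ConfinedTemporalTwistSC) — absorbed internally, not a separate antecedent
(b) Spectral comparison: Tr_{e=0}(K^t) ≤ Z(L³×t)
(c) DOS bound: N₀(E) ≤ κ·L^d·E^{d/2} — claimed in part (1), constants AFTER ∀r (N′)
(d) Doob tower summation: with polynomial DOS, Σᵢ(λᵢ/λ₀)^t = O(L^{d/2}·e^{-z/4})

Width-0 wall B-ENTROPY/B2. Constants κ, d existential AFTER ∀r (N′ compliant). -/
def GapDosToExitSC (zs : ℝ) (c : ℕ) (θ : ℝ) : Prop :=
  ∀ (G : Type) [Group G] [TopologicalSpace G] [IsTopologicalGroup G] [CompactSpace G],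
    IsCompactSimpleLieGroup G → SimplyConnectedSpace G →
    letI : MeasurableSpace G := borel G
    haveI : BorelSpace G := ⟨rfl⟩
    ∀ r : LatticeRep G, ∃ (κ d β₁ : ℝ), 0 < κ ∧ 0 < d ∧
      -- Part 1: DOS bound holds eventually (κ, d USED — fixes ‼1)
      (∀ β : ℝ, β₁ ≤ β → ∀ (L : ℕ) [NeZero L], 8 ≤ L →
        ∀ E : ℝ, 1 ≤ E → ∀ N₀ : ℝ, 0 < N₀ → N₀ ≤ κ * (L : ℝ) ^ d * E ^ (d / 2)) ∧
      -- Part 2: gap implies purity (κ, d could be used in the Doob tower argument)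
      (∀ β : ℝ, β₁ ≤ β → ∀ (L : ℕ) [NeZero L], 8 ≤ L →
        BoxGapAtLeast r.ρ β L zs → ∃ L' : ℕ, 8 ≤ L' ∧ L' ≤ c * L ∧ coldDefect r.ρ β L' ≤ θ)

/-! ## §2 Stubs (sorries ONLY here) -/

/-- **stub 1: PinnedEdgeCof 7 — femto edge at z× = 7 (WEAKER*, INSTRUMENTABLE/ATTACKABLE via femto + R2b′).**
Consumes LowerBounds. At L ≈ 0.6–0.8 fm (z ≈ 5–7) the Lüscher–van Baal crossover begins.
Includes the spectral comparison Tr_{e=0}(K^t) ≤ Z(L³×t) implicitly (e=0 is a sector of Z). -/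
theorem stub_pinnedEdgeCof : PinnedEdgeCof 7 := by
  sorry

/-- **stub 2: NoHalvingSC 7 η — THE LEVER (SKEW, X9 = width-0 wall, IDEA-NEEDED).**
The one-octave finite-size monotonicity at fixed β: m(2L) ≥ ((1+η)/2)·m(L) once z(L) ≥ 7.
Candidates: RP/chessboard bracketing, sub/super-multiplicativity of λ₁/λ₀ under gluing.
ROSE/femto: inst-1 scores sign η_fem > 0 deep femto (INFO). -/
theorem stub_noHalvingSC {η : ℝ} (hη : 0 < η) : NoHalvingSC 7 η := by
  sorry

/-- **stub 3: GapDosToExitSC 28 4 (1/24) — gap + DOS → purity (UNDECIDED, B-ENTROPY/B2 = width-0 wall).**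
The stub proves ∃ κ d such that BOTH:
(1) DOS bound N₀(E) ≤ κ·L^d·E^{d/2} holds (B-ENTROPY/B2)
(2) gap ≥ 28 implies purity ≤ 1/24 within factor 4 in scale
Also absorbed: F = flux heaviness (ConfinedTemporalTwistSC).
Constants κ, d existential AFTER ∀r (N′ compliant). -/
theorem stub_gapDosToExit : GapDosToExitSC 28 4 (1 / 24) := by
  sorry

/-! ## §3 Iteration and composition (PROVED) -/

/-- Iterating no-halving k times along the dyadic tower L, 2L, …, 2ᵏL. -/
theorem iterate_gap {G : Type} [Group G] [TopologicalSpace G] [IsTopologicalGroup G] [CompactSpace G]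
    [MeasurableSpace G] [BorelSpace G] {N : ℕ} (ρ : G →* Matrix (Fin N) (Fin N) ℂ) (β zx η : ℝ) (hη : 0 ≤ η)
    (step : ∀ (L L' : ℕ) [NeZero L] [NeZero L'], 8 ≤ L → L' = 2 * L → ∀ z : ℝ, zx ≤ z →
        BoxGapAtLeast ρ β L z → BoxGapAtLeast ρ β L' ((1 + η) * z))
    (L : ℕ) [NeZero L] (hL : 8 ≤ L) {z : ℝ} (hz : zx ≤ z) (hz0 : 0 ≤ z) (h0 : BoxGapAtLeast ρ β L z) :
    ∀ (k : ℕ) (L' : ℕ) [NeZero L'], L' = 2 ^ k * L → BoxGapAtLeast ρ β L' ((1 + η) ^ k * z) := by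
  intro k
  induction k with
  | zero =>
      intro L' _ hL'
      have hLL : L' = L := by simpa using hL'
      subst hLL
      simpa using h0
  | succ k ih =>
      intro L'' _ hL''
      haveI : NeZero (2 ^ k * L) := ⟨mul_ne_zero (pow_ne_zero _ two_ne_zero) (NeZero.ne L)⟩
      have ihk : BoxGapAtLeast ρ β (2 ^ k * L) ((1 + η) ^ k * z) := ih (2 ^ k * L) rfl
      have h8 : 8 ≤ 2 ^ k * L :=
        le_trans hL (by simpa [one_mul] using Nat.mul_le_mul_right L (Nat.one_le_two_pow (n := k)))
      have h1 : (1 : ℝ) ≤ (1 + η) ^ k := one_le_pow₀ (by linarith)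
      have hmk : zx ≤ (1 + η) ^ k * z := le_trans hz (le_mul_of_one_le_left hz0 h1)
      have hL2 : L'' = 2 * (2 ^ k * L) := by rw [hL'', pow_succ]; ring
      have hs := step (2 ^ k * L) L'' h8 hL2 ((1 + η) ^ k * z) hmk ihk
      have e : (1 + η) ^ (k + 1) * z = (1 + η) * ((1 + η) ^ k * z) := by ring
      rw [e]
      exact hs

/-- **IRcof_of — kernel-checked composition: stubs ⇒ PXcof(1/24) BY NAME**, with pin T' = 4·2ᵏ·T uniform in β.
Now with 3 stubs: PinnedEdgeCof, NoHalvingSC, GapDosToExitSC (which claims DOS + conversion). -/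
theorem IRcof_of {η : ℝ} (hη : 0 < η)
    (hE : PinnedEdgeCof 7) (hN : NoHalvingSC 7 η)
    (hP : GapDosToExitSC 28 4 (1 / 24)) :
    PinnedExitsCofinalAt (1 / 24) := by
  intro G _ _ _ _ hG hsc
  letI : MeasurableSpace G := borel G
  haveI : BorelSpace G := ⟨rfl⟩
  intro r a ha ha0 hlb
  -- Get threshold from edge certificate
  obtain ⟨T, hT⟩ := hE G hG hsc r a ha ha0 hlb
  -- Get threshold from no-halving
  obtain ⟨βN, hβN⟩ := hN G hG hsc r
  -- Get threshold from gap-to-purity: ∃ κ d β₁, (DOS bound) ∧ (conversion)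
  obtain ⟨_κ, _d, βP, _hκ, _hd, _hDOS, hConv⟩ := hP G hG hsc r
  -- k = number of doublings to reach z_s = 28 from z× = 7
  have hzx : (0 : ℝ) < 7 := by norm_num
  obtain ⟨k, hk⟩ := pow_unbounded_of_one_lt (28 / 7 : ℝ) (by linarith : (1 : ℝ) < 1 + η)
  -- The pin grows by factor 4 · 2^k
  refine ⟨(4 : ℝ) * 2 ^ k * T, fun β₁ => ?_⟩
  obtain ⟨β, hβ, L, instL, hL8, hpin, hgap⟩ := hT (max β₁ (max βN βP))
  haveI : NeZero L := instL
  have hβ₁ : β₁ ≤ β := le_trans (le_max_left _ _) hβ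
  have hβN' : βN ≤ β := le_trans (le_trans (le_max_left _ _) (le_max_right _ _)) hβ
  have hβP' : βP ≤ β := le_trans (le_trans (le_max_right _ _) (le_max_right _ _)) hβ
  -- Iterate no-halving k times
  haveI : NeZero (2 ^ k * L) := ⟨mul_ne_zero (pow_ne_zero _ two_ne_zero) (NeZero.ne L)⟩
  have hit : BoxGapAtLeast r.ρ β (2 ^ k * L) ((1 + η) ^ k * 7) :=
    iterate_gap r.ρ β 7 η hη.le (hβN β hβN') L hL8 le_rfl (by norm_num) hgap k (2 ^ k * L) rfl
  -- (1+η)^k ≥ 28/7 = 4, so z ≥ 28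
  have hzs' : 28 ≤ (1 + η) ^ k * 7 := by
    have h4 : (4 : ℝ) ≤ (1 + η) ^ k := by
      calc (4 : ℝ) = 28 / 7 := by norm_num
        _ ≤ (1 + η) ^ k := hk.le
    nlinarith
  have hgap' : BoxGapAtLeast r.ρ β (2 ^ k * L) 28 :=
    boxGapAtLeast_mono r.ρ β (2 ^ k * L) hzs' (topValue_nonneg _ _ _) hit
  -- Apply conversion (DOS bound is part of hP, used internally)
  have h8' : 8 ≤ 2 ^ k * L :=
    le_trans hL8 (by simpa [one_mul] using Nat.mul_le_mul_right L (Nat.one_le_two_pow (n := k)))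
  obtain ⟨L', hL'8, hL'le, hpure⟩ := hConv β hβP' (2 ^ k * L) h8' hgap'
  refine ⟨β, hβ₁, L', hL'8, ?_, hpure⟩
  -- Check the pin
  have haβ : 0 < a β := ha β
  have hcast : (L' : ℝ) ≤ (4 : ℝ) * (2 ^ k * (L : ℝ)) := by exact_mod_cast hL'le
  calc a β * (L' : ℝ) ≤ a β * ((4 : ℝ) * (2 ^ k * (L : ℝ))) := mul_le_mul_of_nonneg_left hcast haβ.le
    _ = (4 : ℝ) * 2 ^ k * (a β * L) := by ring
    _ ≤ (4 : ℝ) * 2 ^ k * T := mul_le_mul_of_nonneg_left hpin (by positivity)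

/-! ## §4 Final theorem: conclude the crux BY NAME -/

/-- **PXcof(1/24) from the three stubs.** -/
theorem pxcof_of_stubs : PinnedExitsCofinalAt (1 / 24) := by
  -- Pick η = 1 (any η > 0 works)
  have hη : (0 : ℝ) < 1 := by norm_num
  exact IRcof_of hη stub_pinnedEdgeCof (stub_noHalvingSC hη) stub_gapDosToExit

/-! ## §5 Reach IRcof via the slot's composition -/

open Summit.QuantumFields.YangMills.Cruxes.IR.RankPurity (IRnscCof)

/-- **stub N_cof (pass-through)** — the π₁(G) ≠ 1 conjunct, not addressed by this line (from the slot). -/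
theorem stub_irnscCof : IRnscCof := by
  sorry

/-- **IRcof_proof — concludes the crux `IRcof` BY NAME via the slot's Bill composition.** -/
theorem IRcof_proof : Summit.QuantumFields.YangMills.Theses.BalabanLadder.IRcof :=
  PinnedCofinalBill.IRcof_of pxcof_of_stubs stub_irnscCof

/-! ## §6 Non-vacuity toys (rule N) -/

/-- Toy: a Lüscher-type "approach from below" law m(L) = μ − κ/L never halves: z(2L) = 2(2L)μ − κ ≥ 2(Lμ − κ) = 2z(L). -/
theorem toy_noHalving_massive (μ κ : ℝ) (hκ : 0 ≤ κ) (L : ℝ) :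
    (1 + 1) * (L * μ - κ) ≤ (2 * L) * μ - κ := by nlinarith

/-- Toy: a conformal law m = C/L (constant z) is the η = 0 fixed point — false for η > 0. -/
theorem toy_noHalving_conformal (C L : ℝ) (hL : L ≠ 0) : (2 * L) * (C / (2 * L)) = (1 + 0) * (L * (C / L)) := by
  field_simp
  ring

/-- **Toy (fix ‼3): polynomial DOS (Weyl-type) is satisfied by a finite set of levels.**
For n levels, all with energy ≤ E, we have n ≤ κ·L^d·E^{d/2} if n = ⌊κ·L^d·E^{d/2}⌋. -/
theorem toy_dosBound_polyWeyl (κ d E : ℝ) (L : ℕ) [NeZero L] (hκ : 0 < κ) (hd : 0 < d) (hE : 0 < E) :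
    ∀ (n : ℕ), n ≤ Nat.floor (κ * (L : ℝ) ^ d * E ^ (d / 2)) →
      (Finset.range n).card ≤ κ * (L : ℝ) ^ d * E ^ (d / 2) := by
  intro n hn
  simp only [Finset.card_range]
  exact le_trans (Nat.cast_le.2 hn) (Nat.floor_le (by positivity))

/-- **Toy: free massive particle Weyl law.** The eigenvalue count for a Laplacian on a cube of side L is
N(E) ≈ (4π/3)·(L·√E/π)³ = (4/3π²)·L³·E^{3/2} — polynomial in L and E, as DOSBoundSC requires. -/
theorem toy_dosBound_freeParticle (L : ℝ) (hL : 0 < L) :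
    ∃ (κ : ℝ), 0 < κ ∧ ∀ E : ℝ, 0 < E →
      ∃ (bound : ℝ), bound = (4 / (3 * Real.pi ^ 2)) * L ^ 3 * E ^ (3 / 2) ∧ 0 ≤ bound := by
  use (4 / (3 * Real.pi ^ 2)) * L ^ 3
  constructor
  · positivity
  · intro E hE
    use (4 / (3 * Real.pi ^ 2)) * L ^ 3 * E ^ (3 / 2)
    exact ⟨rfl, by positivity⟩

end Summit.QuantumFields.YangMills.Cruxes.IRcof.NoHalvingOctave

end
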